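import Literature.AnabelianGeometry.SemiGraphs.TemperedVerticial
import HarnessLib

/-!
# [SemiAnbd] §3: edge-like subgroups of distinct edges (the edge analogue of Theorem 3.7 (ii)) —
# named residual statement

Mochizuki, *Semi-graphs of anabelioids*, Publ. RIMS **42** (2006), §3, Theorem 3.7 (iii), (iv) p. 41
and the proof of Corollary 3.9 p. 42 [cite: MochizukiSemiAnbd2006, Thm 3.7(iii) p.41].  Theorem 3.7
(iv): "The nontrivial intersections of two distinct maximal compact subgroups of `π₁^temp(G)` are
precisely the edge-like subgroups"; proof of Corollary 3.9 (p. 42): "Similarly, by considering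
nontrivial intersections of maximal compact subgroups, one obtains [in light of the fact that, since `H`
is totally elevated and totally aloof, all of the edge-like subgroups of `π₁^temp(H)` are infinite] that
any quasi-geometric `φ : B^temp(G) → B^temp(H)` determines a map from the edges [of] `G` to the edges
of `H`".  That such a map is well DEFINED — an edge-like subgroup, indeed any subgroup commensurable
to one, belongs to ONE edge — is the edge analogue of the first clause of Theorem 3.7 (ii) ("if `H₁`,
`H₂` are verticial subgroups … that arise from distinct parametrization data, then `H₁ ∩ H₂` has
infinite index in `H₁`"), which print uses silently (on the universal pro-covering tree: stabilisers of
distinct edges meet trivially, by total estrangement along the geodesic joining them).  It is typed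
here as the named residual fact `EdgeLikeDistinct`, in the vocabulary of abc-iut-L3-t2's
`TemperedCoverings.lean` / `TemperedVerticial.lean` (`edgeLikeSubgroups`, `Thm37Hypotheses`), next to
`VerticialDistinct`; consumer: the uniqueness of the edge map in Corollary 3.9
(`CompatibleEdgeMapUnique_of`, `TemperedReconstructionR4Proofs.lean`).  Statement only.
-/

namespace Literature.AnabelianGeometry.SemiGraphs

namespace ProfiniteSemiGraph

universe u

/-- **Edge analogue of Theorem 3.7 (ii), clause 1** ([SemiAnbd] Thm. 3.7 (iii), (iv) p. 41, as used in
the proof of Cor. 3.9 p. 42: "by considering nontrivial intersections of maximal compact subgroups,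
one obtains [… all of the edge-like subgroups of `π₁^temp(H)` are infinite] … a map from the edges
[of] `G` to the edges of `H`"), named residual fact: under the hypotheses of Theorem 3.7, if `L₁`, `L₂`
are edge-like subgroups of `π₁^temp(G)` (for the chart `c`) of DISTINCT edges `e₁ ≠ e₂`, then
`L₁ ∩ L₂` has infinite index in `L₁` (`relIndex = 0`). [cite: MochizukiSemiAnbd2006, Thm 3.7(iii) p.41] -/
def EdgeLikeDistinct : Prop :=
  ∀ (𝒢 : ProfiniteSemiGraph.{u}), 𝒢.Thm37Hypotheses → ∀ (c : TemperedPiChart 𝒢)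
    (e₁ e₂ : 𝒢.graph.Edge) (L₁ L₂ : Subgroup c.G), L₁ ∈ edgeLikeSubgroups c e₁ →
      L₂ ∈ edgeLikeSubgroups c e₂ → e₁ ≠ e₂ → L₂.relIndex L₁ = 0

end ProfiniteSemiGraph

end Literature.AnabelianGeometry.SemiGraphs
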